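import Mathlib
import HarnessLib
import Summits.Ventures.LatticeQCDFlow.Scoring.ChainWindowAverages

/-!
# THE CLT FOR WEIGHTED BATCH SUMS AT A FIXED NUMBER OF BATCHES, from any start:
# `(Σ_{j<a} u_j Σ_{r<b_n} f̄(X_{b_n j+r}))/√b_n ⇒ N(0, σ²_f Σ_{j<a} u_j²)` as `b_n → ∞`

HONEST FRAMING: exact (Metropolis-corrected) sampling algorithms for lattice gauge theory;
figures of merit are autocorrelation/cost numbers at stated couplings and volumes; no
continuum-physics claim.

Venture `LatticeQCDFlow` (cell pub-lqcd), topic `Scoring`; FANOUT row 4 (`s0-u1-b`, GEN-32).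
NEW WORK of the cell, not a published result; no definition is introduced; nothing is cited as a
fact.  Every batch-means limit theorem of the tree so far lets the NUMBER of batches `a_n → ∞`
(`Scoring/BatchMeansCLT.lean` and its descendants) or keeps the batch LENGTH fixed
(`Scoring/BatchMeansFixedBatch.lean`).  The practice of binned / jackknife error bars is the third
regime: a FIXED number `a` of batches (bins) of length `b_n → ∞`.  This file proves the
one-dimensional limit theorem that feeds its joint CLT (`Scoring/BatchMeansJointCLT.lean`, by the
tree's Cramér–Wold device): for every kernel with a geometric sup-norm envelope `(A, ρ)`, every
bounded measurable `f`, every weight vector `u` and EVERY initial law, the weighted sum of the `a`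
centred batch sums, scaled by `√b_n`, is asymptotically `N(0, σ²_f Σ_{j<a} u_j²)`, `σ²_f` the
Green–Kubo variance.  Proof: with the bounded Poisson solution `h` of the envelope (`f̄ = h − κh`),
each batch sum is a block martingale plus a boundary term `h(X_{bj}) − h(X_{bj+b})` of size `≤ 2C_h`
(negligible after `/√b_n`); the weighted block martingales form a triangular array with increments
`≤ 2C_h (Σ_j |u_j|)/√b_n`, orthogonal to the past (`Scoring/ChainMartingaleIncrements`), whose
quadratic variation `Σ_j u_j² · (1/b_n) Σ_{i<b_n} D²_{b_n j+i}` tends to `πq · Σ_j u_j² = σ²_f Σ_j u_j²`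
in `L¹` uniformly in the start (`Scoring/ChainWindowAverages.lean`); McLeish's array CLT
(`Scoring/MartingaleArrayCLT.lean`) concludes.  Printed counterpart NAMED ONLY: batch means with a
fixed number of batches, whose batch means are asymptotically i.i.d. normal (Schmeiser 1982;
Glynn–Iglehart 1990), nothing cited as a fact.

## Content (envelope `(A, ρ)`, `0 ≤ A`, `0 ≤ ρ < 1`, `π` invariant for the second theorem;
## `|h| ≤ C_h`, `|f| ≤ C` measurable; `P_{μ₀}` from ANY `μ₀`; `M_{s,b} = Σ_{r<b} (h(X_{s+r+1}) − κh(X_{s+r}))`)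

* **`chain_weightedBlockMartingale_clt_of_envelope`** — `(Σ_{j<a} u_j M_{b_n j, b_n})/√b_n ⇒ N(0, πq Σ_j u_j²)`;
* **`chain_weightedBlockSum_clt_of_envelope`** — `(Σ_{j<a} u_j Σ_{r<b_n} f̄(X_{b_n j+r}))/√b_n ⇒ N(0, σ²_f Σ_j u_j²)`.

NOT CLAIMED: a growing number of batches (that is `Scoring/BatchMeansCLT.lean`); rates; unbounded
`f`; any number of ours.
-/

noncomputable section

namespace Summit.Ventures.LatticeQCDFlow.Scoring

open MeasureTheory ProbabilityTheory Filter Finset Preorder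
open scoped ENNReal Topology RealInnerProductSpace

variable {Ω : Type*} [MeasurableSpace Ω]

section Envelope

variable {κ : Kernel Ω Ω} [IsMarkovKernel κ] {π : Measure Ω} [IsProbabilityMeasure π] {A ρ : ℝ}

/-! ### The CLT for weighted block martingales at a fixed number of blocks -/

/-- **THE CLT FOR WEIGHTED BLOCK MARTINGALES AT A FIXED NUMBER OF BLOCKS, FROM ANY START.**
Envelope `(A, ρ)` (`0 ≤ A`, `0 ≤ ρ < 1`), `|h| ≤ C_h` measurable, `m = ∫ q dπ`
(`q = κ(h²) − (κh)²`); weights `u : ℕ → ℝ`, a FIXED number `a` of blocks, block length `b_n → ∞`,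
`μ₀` ANY initial law.  For every real random variable `Y` with law `N(0, m Σ_{j<a} u_j²)`:
`(Σ_{j<a} u_j M_{b_n j, b_n}) / √b_n ⇒ Y`, `M_{s,b} = Σ_{r<b} (h(X_{s+r+1}) − κh(X_{s+r}))`. -/
theorem chain_weightedBlockMartingale_clt_of_envelope
    (henv : ∀ (g : Ω → ℝ), Measurable g → ∀ (Cg : ℝ), (∀ x, |g x| ≤ Cg) →
      ∀ (t : ℕ) (x : Ω), |(kop κ)^[t] g x - ∫ y, g y ∂π| ≤ 2 * Cg * (A * ρ ^ t))
    (hA : 0 ≤ A) (hρ0 : 0 ≤ ρ) (hρ1 : ρ < 1)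
    {h : Ω → ℝ} (hh : Measurable h) {Ch : ℝ} (hCh : ∀ x, |h x| ≤ Ch)
    (μ₀ : Measure Ω) [IsProbabilityMeasure μ₀] (u : ℕ → ℝ) (a : ℕ) {b : ℕ → ℕ}
    (hb : Tendsto b atTop atTop)
    {Ω' : Type*} [MeasurableSpace Ω'] {P' : Measure Ω'} [IsProbabilityMeasure P'] {Y : Ω' → ℝ}
    (hY : HasLaw Y (gaussianReal 0 (Real.toNNReal ((∑ j ∈ Finset.range a, u j ^ 2)
      * ∫ y, (kop κ (fun y => h y ^ 2) y - (kop κ h y) ^ 2) ∂π))) P')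
    [IsProbabilityMeasure (Kernel.trajMeasure (X := fun _ : ℕ => Ω) (μ₀)
          (fun n : ℕ => κ.comap (fun h' : (i : ↥(Finset.Iic n)) → Ω => h' ⟨n, Finset.mem_Iic.2 le_rfl⟩)
            (measurable_pi_apply _)))] :
    TendstoInDistribution (fun (n : ℕ) (x : ℕ → Ω) =>
        (∑ j ∈ Finset.range a, u j * ∑ r ∈ Finset.range (b n), (h (x (b n * j + r + 1)) - kop κ h (x (b n * j + r))))
          / Real.sqrt (b n))
      atTop Y (fun _ => (Kernel.trajMeasure (X := fun _ : ℕ => Ω) (μ₀)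
            (fun n : ℕ => κ.comap (fun h' : (i : ↥(Finset.Iic n)) → Ω => h' ⟨n, Finset.mem_Iic.2 le_rfl⟩)
              (measurable_pi_apply _)))) P' := by
  set P := (Kernel.trajMeasure (X := fun _ : ℕ => Ω) (μ₀)
        (fun n : ℕ => κ.comap (fun h' : (i : ↥(Finset.Iic n)) → Ω => h' ⟨n, Finset.mem_Iic.2 le_rfl⟩)
          (measurable_pi_apply _))) with hP
  set m : ℝ := ∫ y, (kop κ (fun y => h y ^ 2) y - (kop κ h y) ^ 2) ∂π with hm
  obtain ⟨x0⟩ := nonempty_of_isProbabilityMeasure μ₀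
  have hC0 : 0 ≤ Ch := (abs_nonneg _).trans (hCh x0)
  -- truncated weights and their bound
  set w : ℕ → ℝ := fun j => if j < a then u j else 0 with hw
  set U : ℝ := ∑ j ∈ Finset.range a, |u j| with hU
  have hU0 : 0 ≤ U := Finset.sum_nonneg fun j _ => abs_nonneg _
  have hwb : ∀ j, |w j| ≤ U := by
    intro j
    simp only [hw]
    split_ifs with hj
    · exact Finset.single_le_sum (f := fun j => |u j|) (fun i _ => abs_nonneg _) (Finset.mem_range.2 hj)
    · rw [abs_zero]; exact hU0
  have hDm : ∀ t, Measurable fun x : ℕ → Ω => h (x (t + 1)) - kop κ h (x t) := fun t =>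
    (hh.comp (measurable_pi_apply _)).sub ((measurable_kop κ hh).comp (measurable_pi_apply _))
  have hDb : ∀ t (x : ℕ → Ω), |h (x (t + 1)) - kop κ h (x t)| ≤ 2 * Ch := fun t x =>
    (abs_sub _ _).trans (by linarith [hCh (x (t + 1)), abs_kop_le κ hCh (x t)])
  -- the array
  set ζ : ℕ → ℕ → (ℕ → Ω) → ℝ := fun n t x =>
    w (b n * (t / b n) / b n) * (h (x (b n * (t / b n) + t % b n + 1)) - kop κ h (x (b n * (t / b n) + t % b n)))
      / Real.sqrt (b n) with hζ
  have hst : ∀ n t, b n * (t / b n) + t % b n = t := fun n t => Nat.div_add_mod t (b n)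
  -- (i) measurability
  have hζm : ∀ n t, Measurable (ζ n t) := by
    intro n t
    simp only [hζ, hst]
    exact ((hDm t).const_mul _).div_const _
  -- (ii) uniform smallness
  have hc : ∀ n t x, |ζ n t x| ≤ U * (2 * Ch) / Real.sqrt (b n) := by
    intro n t x
    simp only [hζ, hst]
    rcases Nat.eq_zero_or_pos (b n) with hb0 | hb0
    · rw [hb0, Nat.cast_zero, Real.sqrt_zero, div_zero, div_zero, abs_zero]
    have hsb : 0 < Real.sqrt (b n) := Real.sqrt_pos.2 (Nat.cast_pos.2 hb0)
    rw [abs_div, abs_of_pos hsb, abs_mul]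
    exact div_le_div_of_nonneg_right (mul_le_mul (hwb _) (hDb t x) (abs_nonneg _) hU0) hsb.le
  have hc0 : Tendsto (fun n => U * (2 * Ch) / Real.sqrt (b n)) atTop (𝓝 0) :=
    tendsto_const_nhds.div_atTop (Real.tendsto_sqrt_atTop.comp
      ((tendsto_natCast_atTop_atTop (R := ℝ)).comp hb))
  -- (iii) orthogonality to the past increments
  have horth : ∀ (n t : ℕ) (F : (Fin t → ℝ) → ℝ) (K' : ℝ), Measurable F → (∀ w, |F w| ≤ K') →
      ∫ x, F (fun i => ζ n i x) * ζ n t x ∂P = 0 := by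
    intro n t F K' hF hFb
    have hGm : Measurable fun x : ℕ → Ω => F (fun i : Fin t => ζ n i x) :=
      hF.comp (measurable_pi_lambda _ fun i => hζm n i)
    have hGd : DependsOn (fun x : ℕ → Ω => F (fun i : Fin t => ζ n i x)) (Set.Iic t) := by
      intro x y hxy
      show F (fun i : Fin t => ζ n i x) = F (fun i : Fin t => ζ n i y)
      congr 1
      funext i
      simp only [hζ, hst]
      have hi : (i : ℕ) + 1 ≤ t := i.2
      rw [hxy ((i : ℕ) + 1) (Set.mem_Iic.2 hi), hxy (i : ℕ) (Set.mem_Iic.2 (by omega))]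
    have key := chain_increment_orthogonal κ μ₀ t hGm hGd (fun x => hFb _) hh hCh
    rw [← hP] at key
    have : ∀ x : ℕ → Ω, F (fun i : Fin t => ζ n i x) * ζ n t x
        = (w (b n * (t / b n) / b n) / Real.sqrt (b n))
          * (F (fun i : Fin t => ζ n i x) * (h (x (t + 1)) - kop κ h (x t))) := fun x => by
      simp only [hζ, hst]; ring
    simp_rw [this]
    rw [integral_const_mul, key, mul_zero]
  -- (iv) the quadratic variation, block by block
  have hQVeq : ∀ n x, 0 < b n → ∑ t ∈ Finset.range (a * b n), ζ n t x ^ 2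
      = ∑ j ∈ Finset.range a, u j ^ 2
          * ((∑ i ∈ Finset.range (b n), (h (x (b n * j + i + 1)) - kop κ h (x (b n * j + i))) ^ 2) / (b n : ℝ)) := by
    intro n x hb0
    simp only [hζ]
    rw [sum_range_mul_div_mod (fun s i => (w (s / b n) * (h (x (s + i + 1)) - kop κ h (x (s + i)))
      / Real.sqrt (b n)) ^ 2) a (b n)]
    refine Finset.sum_congr rfl fun j hj => ?_
    have hwj : w (b n * j / b n) = u j := by
      rw [Nat.mul_div_cancel_left j hb0]; simp only [hw, if_pos (Finset.mem_range.1 hj)]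
    simp only [hwj]
    rw [Finset.sum_div, Finset.mul_sum]
    refine Finset.sum_congr rfl fun i _ => ?_
    rw [div_pow, mul_pow, Real.sq_sqrt (Nat.cast_nonneg (b n))]
    ring
  have hQm : ∀ n j, Measurable fun x : ℕ → Ω =>
      (∑ i ∈ Finset.range (b n), (h (x (b n * j + i + 1)) - kop κ h (x (b n * j + i))) ^ 2) / (b n : ℝ) :=
    fun n j => (Finset.measurable_sum _ fun i _ => (hDm _).pow_const 2).div_const _
  have hQb : ∀ n j (x : ℕ → Ω), 0 < b n →
      |(∑ i ∈ Finset.range (b n), (h (x (b n * j + i + 1)) - kop κ h (x (b n * j + i))) ^ 2) / (b n : ℝ)|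
        ≤ (2 * Ch) ^ 2 := by
    intro n j x hb0
    have hbR : (0 : ℝ) < b n := Nat.cast_pos.2 hb0
    rw [abs_div, abs_of_pos hbR, div_le_iff₀ hbR, abs_of_nonneg (Finset.sum_nonneg fun i _ => sq_nonneg _)]
    calc ∑ i ∈ Finset.range (b n), (h (x (b n * j + i + 1)) - kop κ h (x (b n * j + i))) ^ 2
        ≤ ∑ _i ∈ Finset.range (b n), (2 * Ch) ^ 2 := Finset.sum_le_sum fun i _ => by
          have := abs_le.1 (hDb (b n * j + i) x)
          exact sq_le_sq' this.1 this.2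
      _ = (2 * Ch) ^ 2 * b n := by rw [Finset.sum_const, Finset.card_range, nsmul_eq_mul]; ring
  have hQV : TendstoInMeasure P (fun n x => ∑ t ∈ Finset.range (a * b n), ζ n t x ^ 2) atTop
      (fun _ => (∑ j ∈ Finset.range a, u j ^ 2) * m) := by
    set K₁ : ℝ := 4 * Ch ^ 2 + Real.sqrt 10 * (4 * Ch ^ 2 * A / (1 - ρ)) with hK₁
    have hev : ∀ᶠ n in atTop, 0 < b n := hb.eventually_gt_atTop 0
    refine tendstoInMeasure_const_of_integral_abs_le P
      (fun n => Finset.measurable_sum _ fun t _ => (hζm n t).pow_const 2)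
      (K := fun n => (a * b n : ℕ) * (U * (2 * Ch) / Real.sqrt (b n)) ^ 2)
      (fun n x => ?_) (ε := fun n => (∑ j ∈ Finset.range a, u j ^ 2) * K₁ / Real.sqrt (b n)) ?_ ?_
    · rw [abs_of_nonneg (Finset.sum_nonneg fun t _ => sq_nonneg _)]
      calc ∑ t ∈ Finset.range (a * b n), ζ n t x ^ 2
          ≤ ∑ _t ∈ Finset.range (a * b n), (U * (2 * Ch) / Real.sqrt (b n)) ^ 2 :=
            Finset.sum_le_sum fun t _ => by
              have := abs_le.1 (hc n t x)
              exact sq_le_sq' this.1 this.2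
        _ = (a * b n : ℕ) * (U * (2 * Ch) / Real.sqrt (b n)) ^ 2 := by
            rw [Finset.sum_const, Finset.card_range, nsmul_eq_mul]
    · filter_upwards [hev] with n hn
      have hbn : b n ≠ 0 := Nat.pos_iff_ne_zero.1 hn
      have hterm : ∀ j ∈ Finset.range a,
          ∫ x, |u j ^ 2 * ((∑ i ∈ Finset.range (b n), (h (x (b n * j + i + 1)) - kop κ h (x (b n * j + i))) ^ 2) / (b n : ℝ)) - u j ^ 2 * m| ∂P
            ≤ u j ^ 2 * (K₁ / Real.sqrt (b n)) := by
        intro j _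
        have hL := chain_condVarAverage_abs_sub_le_of_envelope henv hA hρ0 hρ1 hh hCh μ₀ (b n * j) hbn
        rw [← hP, ← hm] at hL
        have heq : ∀ x : ℕ → Ω,
            |u j ^ 2 * ((∑ i ∈ Finset.range (b n), (h (x (b n * j + i + 1)) - kop κ h (x (b n * j + i))) ^ 2) / (b n : ℝ)) - u j ^ 2 * m|
              = u j ^ 2 * |(∑ i ∈ Finset.range (b n), (h (x (b n * j + i + 1)) - kop κ h (x (b n * j + i))) ^ 2) / (b n : ℝ) - m| := fun x => by
          rw [← mul_sub, abs_mul, abs_of_nonneg (sq_nonneg _)]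
        simp_rw [heq]
        rw [integral_const_mul]
        exact mul_le_mul_of_nonneg_left hL (sq_nonneg _)
      have hint : ∀ j ∈ Finset.range a, Integrable (fun x : ℕ → Ω =>
          |u j ^ 2 * ((∑ i ∈ Finset.range (b n), (h (x (b n * j + i + 1)) - kop κ h (x (b n * j + i))) ^ 2) / (b n : ℝ)) - u j ^ 2 * m|) P :=
        fun j _ => integrable_of_bounded P (((hQm n j).const_mul _).sub measurable_const).abs
          (C := u j ^ 2 * (2 * Ch) ^ 2 + |u j ^ 2 * m|) fun x => by
            rw [abs_abs]
            refine (abs_sub _ _).trans (add_le_add ?_ le_rfl)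
            rw [abs_mul, abs_of_nonneg (sq_nonneg _)]
            exact mul_le_mul_of_nonneg_left (hQb n j x hn) (sq_nonneg _)
      calc ∫ x, |∑ t ∈ Finset.range (a * b n), ζ n t x ^ 2 - (∑ j ∈ Finset.range a, u j ^ 2) * m| ∂P
          = ∫ x, |∑ j ∈ Finset.range a, (u j ^ 2 * ((∑ i ∈ Finset.range (b n), (h (x (b n * j + i + 1)) - kop κ h (x (b n * j + i))) ^ 2) / (b n : ℝ)) - u j ^ 2 * m)| ∂P := by
            refine integral_congr_ae (ae_of_all _ fun x => ?_)
            beta_reduce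
            rw [hQVeq n x hn, Finset.sum_mul, ← Finset.sum_sub_distrib]
        _ ≤ ∫ x, ∑ j ∈ Finset.range a, |u j ^ 2 * ((∑ i ∈ Finset.range (b n), (h (x (b n * j + i + 1)) - kop κ h (x (b n * j + i))) ^ 2) / (b n : ℝ)) - u j ^ 2 * m| ∂P :=
            integral_mono_of_nonneg (ae_of_all _ fun x => abs_nonneg _) (integrable_finsetSum _ hint)
              (ae_of_all _ fun x => Finset.abs_sum_le_sum_abs _ _)
        _ = ∑ j ∈ Finset.range a, ∫ x, |u j ^ 2 * ((∑ i ∈ Finset.range (b n), (h (x (b n * j + i + 1)) - kop κ h (x (b n * j + i))) ^ 2) / (b n : ℝ)) - u j ^ 2 * m| ∂P :=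
            integral_finsetSum _ hint
        _ ≤ ∑ j ∈ Finset.range a, u j ^ 2 * (K₁ / Real.sqrt (b n)) := Finset.sum_le_sum hterm
        _ = (∑ j ∈ Finset.range a, u j ^ 2) * K₁ / Real.sqrt (b n) := by
            rw [← Finset.sum_mul]; ring
    · exact tendsto_const_nhds.div_atTop (Real.tendsto_sqrt_atTop.comp
        ((tendsto_natCast_atTop_atTop (R := ℝ)).comp hb))
  -- (v) McLeish
  have hv : (0 : ℝ) ≤ (∑ j ∈ Finset.range a, u j ^ 2) * m := by
    refine mul_nonneg (Finset.sum_nonneg fun j _ => sq_nonneg _) ?_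
    exact integral_nonneg fun y => kopCondVar_nonneg κ hh hCh y
  have hclt := tendstoInDistribution_rowSum_of_orthogonal (P := P) (k := fun n => a * b n) hζm hc
    hc0 horth hv hQV hY
  -- (vi) identify the row sums with the statistic (eventually, `b_n > 0`)
  have hrow : ∀ n x, 0 < b n → ∑ t ∈ Finset.range (a * b n), ζ n t x
      = (∑ j ∈ Finset.range a, u j * ∑ r ∈ Finset.range (b n), (h (x (b n * j + r + 1)) - kop κ h (x (b n * j + r))))
          / Real.sqrt (b n) := by
    intro n x hb0
    simp only [hζ]
    rw [sum_range_mul_div_mod (fun s i => w (s / b n) * (h (x (s + i + 1)) - kop κ h (x (s + i)))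
      / Real.sqrt (b n)) a (b n), Finset.sum_div]
    refine Finset.sum_congr rfl fun j hj => ?_
    have hwj : w (b n * j / b n) = u j := by
      rw [Nat.mul_div_cancel_left j hb0]; simp only [hw, if_pos (Finset.mem_range.1 hj)]
    simp only [hwj, Finset.mul_sum, Finset.sum_div]
  have hX : ∀ n, AEMeasurable (fun x : ℕ → Ω =>
      (∑ j ∈ Finset.range a, u j * ∑ r ∈ Finset.range (b n), (h (x (b n * j + r + 1)) - kop κ h (x (b n * j + r))))
        / Real.sqrt (b n)) P := fun n =>
    ((Finset.measurable_sum _ fun j _ => (Finset.measurable_sum _ fun r _ => hDm _).const_mul _).div_const _).aemeasurable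
  refine tendstoInDistribution_of_tendstoInMeasure_sub (X := fun n x => ∑ t ∈ Finset.range (a * b n), ζ n t x)
    _ Y hclt ?_ hX
  have h0 : TendstoInMeasure P (fun (_ : ℕ) (_ : ℕ → Ω) => (0 : ℝ)) atTop (fun _ => (0 : ℝ)) :=
    tendstoInMeasure_of_tendsto_ae (fun _ => aestronglyMeasurable_const)
      (ae_of_all _ fun _ => tendsto_const_nhds)
  refine h0.congr' ?_ EventuallyEq.rfl
  filter_upwards [hb.eventually_gt_atTop 0] with n hn
  exact ae_of_all _ fun x => by simp only [Pi.sub_apply, hrow n x hn, sub_self]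

/-! ### From block martingales to block sums: the weighted batch sums -/

/-- **THE CLT FOR WEIGHTED BATCH SUMS AT A FIXED NUMBER OF BATCHES, FROM ANY START.**  `π`
invariant, envelope `(A, ρ)` (`0 ≤ A`, `0 ≤ ρ < 1`), `|f| ≤ C` measurable, `f̄ = f − πf`,
`σ²_f = ∫ f̄² dπ + 2 Σ_{k≥0} ∫ f̄ · κ^{k+1} f̄ dπ`; weights `u : ℕ → ℝ`, a FIXED number `a` of batches
of length `b_n → ∞`; `μ₀` ANY initial law.  For every `Y ∼ N(0, σ²_f Σ_{j<a} u_j²)`: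
`(Σ_{j<a} u_j Σ_{r<b_n} f̄(X_{b_n j + r})) / √b_n ⇒ Y`.  (Block sums differ from block martingales
of the Poisson solution by boundary terms `h(X_{bj}) − h(X_{bj+b})` of size `≤ 2C_h`, negligible
after `/√b_n`; `∫ q dπ = σ²_f` by `poisson_condVar_integral_eq_greenKubo_of_envelope`.) -/
theorem chain_weightedBlockSum_clt_of_envelope (hπ : Kernel.Invariant κ π)
    (henv : ∀ (g : Ω → ℝ), Measurable g → ∀ (Cg : ℝ), (∀ x, |g x| ≤ Cg) →
      ∀ (t : ℕ) (x : Ω), |(kop κ)^[t] g x - ∫ y, g y ∂π| ≤ 2 * Cg * (A * ρ ^ t))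
    (hA : 0 ≤ A) (hρ0 : 0 ≤ ρ) (hρ1 : ρ < 1)
    {f : Ω → ℝ} (hf : Measurable f) {C : ℝ} (hC : ∀ x, |f x| ≤ C)
    (μ₀ : Measure Ω) [IsProbabilityMeasure μ₀] (u : ℕ → ℝ) (a : ℕ) {b : ℕ → ℕ}
    (hb : Tendsto b atTop atTop)
    {Ω' : Type*} [MeasurableSpace Ω'] {P' : Measure Ω'} [IsProbabilityMeasure P'] {Y : Ω' → ℝ}
    (hY : HasLaw Y (gaussianReal 0 (Real.toNNReal ((∑ j ∈ Finset.range a, u j ^ 2)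
      * (((∫ y, (f y - ∫ z, f z ∂(π)) ^ 2 ∂(π)) + 2 * ∑' k, ∫ y, (f y - ∫ z, f z ∂(π)) * (kop (κ))^[k + 1] (fun y => f y - ∫ z, f z ∂(π)) y ∂(π)))))) P')
    [IsProbabilityMeasure (Kernel.trajMeasure (X := fun _ : ℕ => Ω) (μ₀)
          (fun n : ℕ => κ.comap (fun h' : (i : ↥(Finset.Iic n)) → Ω => h' ⟨n, Finset.mem_Iic.2 le_rfl⟩)
            (measurable_pi_apply _)))] :
    TendstoInDistribution (fun (n : ℕ) (x : ℕ → Ω) =>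
        (∑ j ∈ Finset.range a, u j * ∑ r ∈ Finset.range (b n), (f (x (b n * j + r)) - ∫ z, f z ∂π))
          / Real.sqrt (b n))
      atTop Y (fun _ => (Kernel.trajMeasure (X := fun _ : ℕ => Ω) (μ₀)
            (fun n : ℕ => κ.comap (fun h' : (i : ↥(Finset.Iic n)) → Ω => h' ⟨n, Finset.mem_Iic.2 le_rfl⟩)
              (measurable_pi_apply _)))) P' := by
  set P := (Kernel.trajMeasure (X := fun _ : ℕ => Ω) (μ₀)
        (fun n : ℕ => κ.comap (fun h' : (i : ↥(Finset.Iic n)) → Ω => h' ⟨n, Finset.mem_Iic.2 le_rfl⟩)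
          (measurable_pi_apply _))) with hP
  obtain ⟨h, hh, hCh, hpois⟩ := poisson_exists_of_geometricEnvelope henv hρ0 hρ1 hf hC
  have hq := poisson_condVar_integral_eq_greenKubo_of_envelope hπ henv hρ0 hρ1 hf hC hh hCh hpois
  rw [← hq] at hY
  have hM := chain_weightedBlockMartingale_clt_of_envelope henv hA hρ0 hρ1 hh hCh μ₀ u a hb hY
  obtain ⟨x0⟩ := nonempty_of_isProbabilityMeasure μ₀
  set Ch : ℝ := 4 * C * A / (1 - ρ) with hChdef
  have hC0 : 0 ≤ Ch := (abs_nonneg _).trans (hCh x0)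
  set U : ℝ := ∑ j ∈ Finset.range a, |u j| with hU
  -- the boundary terms
  set R : ℕ → (ℕ → Ω) → ℝ := fun n x =>
    (∑ j ∈ Finset.range a, u j * (h (x (b n * j)) - h (x (b n * j + b n)))) / Real.sqrt (b n) with hR
  have hRm : ∀ n, AEMeasurable (R n) P := fun n =>
    ((Finset.measurable_sum _ fun j _ => ((hh.comp (measurable_pi_apply _)).sub
      (hh.comp (measurable_pi_apply _))).const_mul _).div_const _).aemeasurable
  have hRb : ∀ n x, |R n x| ≤ U * (2 * Ch) / Real.sqrt (b n) := by
    intro n x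
    simp only [hR]
    rcases Nat.eq_zero_or_pos (b n) with hb0 | hb0
    · rw [hb0, Nat.cast_zero, Real.sqrt_zero, div_zero, div_zero, abs_zero]
    have hsb : 0 < Real.sqrt (b n) := Real.sqrt_pos.2 (Nat.cast_pos.2 hb0)
    rw [abs_div, abs_of_pos hsb]
    refine div_le_div_of_nonneg_right ((Finset.abs_sum_le_sum_abs _ _).trans ?_) hsb.le
    rw [hU, Finset.sum_mul]
    refine Finset.sum_le_sum fun j _ => ?_
    rw [abs_mul]
    refine mul_le_mul_of_nonneg_left ((abs_sub _ _).trans ?_) (abs_nonneg _)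
    linarith [hCh (x (b n * j)), hCh (x (b n * j + b n))]
  have hRt : TendstoInMeasure P R atTop (fun _ => (0 : ℝ)) := by
    have hc0 : Tendsto (fun n => U * (2 * Ch) / Real.sqrt (b n)) atTop (𝓝 0) :=
      tendsto_const_nhds.div_atTop (Real.tendsto_sqrt_atTop.comp
        ((tendsto_natCast_atTop_atTop (R := ℝ)).comp hb))
    refine tendstoInMeasure_of_tendsto_ae (fun n => (hRm n).aestronglyMeasurable)
      (ae_of_all _ fun x => ?_)
    exact squeeze_zero_norm (fun n => by rw [Real.norm_eq_abs]; exact hRb n x) hc0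
  have hsum := hM.add_of_tendstoInMeasure_const hRt hRm
  refine hsum.congr (fun n => ae_of_all _ fun x => ?_) (ae_of_all _ fun ω => by rw [add_zero])
  -- the telescoping identity, batch by batch
  show (∑ j ∈ Finset.range a, u j * ∑ r ∈ Finset.range (b n), (h (x (b n * j + r + 1)) - kop κ h (x (b n * j + r))))
          / Real.sqrt (b n) + R n x
      = (∑ j ∈ Finset.range a, u j * ∑ r ∈ Finset.range (b n), (f (x (b n * j + r)) - ∫ z, f z ∂π))
          / Real.sqrt (b n)
  simp only [hR]
  rw [← add_div, ← Finset.sum_add_distrib]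
  congr 1
  refine Finset.sum_congr rfl fun j _ => ?_
  rw [blockSum_eq_blockMartingale_add (kop κ) hpois (b n * j) (b n) x]
  ring

end Envelope

end Summit.Ventures.LatticeQCDFlow.Scoring

end
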